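import Literature.MathematicalPhysics.QuantumFieldTheory.Balaban1983to89.B15Prop1SliceHessianOfChartFamily
import Literature.MathematicalPhysics.QuantumFieldTheory.Balaban1983to89.B15SU2ChartHolomorphic
import Literature.Analysis.Complex.SeveralVariables

/-!
# `Balaban1983to89.B15Prop1RealChartFamilyFromMinimiserChart` — [Balaban1985Variational] = «[15]», Prop. 9 (190) p. 309 («`U(𝔹,V′)` … has an extension to an
# analytic function of Gᶜ-valued small configurations `V′`»), (15) p. 280 («`U = U′U₀`»), p. 307; [Balaban1988Convergent] = «[III]», (2.12)–(2.14) pp. 256–257;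
# [Balaban1989LargeFieldI] = «[IV]», Prop. 1 p. 194 (last clause); [Balaban1989LargeFieldII] = «[LF-II]», p. 359 («Fixing the gauge G₀ for V′ … V′ = exp iB′»):
# ★★★ THE LETTER (K′) OF THE N12∕s1 ASSEMBLY — THE REAL, TWICE-DIFFERENTIABLE FAMILY OF (2.12) MINIMISERS IN THE LEFT-TRIVIALISED EXPONENTIAL CHART
# `Node00.expChart U₀` ALONG PRINT's GAUGE-FIXED COORDINATES `Y ∈ GaugeSlice S T E3`, READ OFF THE INTRINSIC ANALYTIC LETTER (J0′)

Honest framing: statement-level skeleton of published theorems with citation tags; proofs where landed; nothing here is a claim about the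
Yang–Mills mass gap.  Cell `pub-ymgap`, HUMAN RULING D-0154 (R399 (3a) width seats), seat `pub-ymgap-dag-n12-w5` (N12 = [B15]; the lane owner dag-n12-c g17's WORD
«n12-w5 take (K′)», bus l.29129); count-neutral helper of K1⁷ (`stmt-QuantumFields-20542`); N12 NOT discharged; finite 𝕋⁴ at fixed ε; nothing continuum ∕ OS ∕ mass-gap ∕ Clay.

WHY.  The junction (t7) of the N12∕s1 lane (`B15Prop1SliceHessianOfChartFamily`, p604041) turns dag-n12-w4's near-flat one-sided value skeleton into the endpoints' letter
`h17` GIVEN a family letter (K′) = its hypothesis `hval`: a map `X_f : GaugeSlice S T E3 → (bonds → 𝔰𝔲(2))`, `X_f 0 = 0`, of class `C²` at `0`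
(`HasFDerivAt X_f X_f′ 0`, `HasFDerivAt (D X_f) X₂ 0`, differentiable near `0`), such that `Y ↦ expChart U₀ (X_f Y) = U₀·exp(X_f Y)` is, near `Y = 0`, a MINIMAL
CONFIGURATION ([III] (2.12)) for the datum `M˙(Q_k^{s*}(exp(i·ιA Y)·Ṽ_k))`.  The w1 lineage (dag-n12-w1) produces the INTRINSIC ANALYTIC letter (J0′) of the endpoints
(`B15Prop1JointHolomorphyFromMinimiserFamilyOneSided` :102, `B15Prop1ClosedGuardUniformRadius` `hMinK`∕`hMinC`): per base field a chart `Ũ` on the ball of radius `R` of the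
COMPLEXIFIED parameters `(p, B′) ∈ (ℂ³)^{bonds} × (ℂ³)^{bonds}` with ℂ-DIFFERENTIABLE matrix entries which at every REAL point is the matrix field of SOME (2.12) minimiser of
that point's datum — print's «analytic function of Gᶜ-valued small configurations» ([15] Prop. 9 (190)).  The lane owner located (bus l.28813) that the passage
(J0′) ⇒ (K′) «dies at regularity» for want of a several-complex-variables «holomorphic ⇒ smooth» theorem; the tree HAS it — Osgood's lemma and its `C^∞` half are PROVED in
`Literature/Analysis/Complex/SeveralVariables.lean` (`Literature.Analysis.Complex.SCV.contDiffOn_nat`, `…contDiffOn_infty`: Cauchy formula for directional derivatives +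
differentiation under the integral) and `…/OsgoodProofs.lean` (`SCV.analyticOnNhd_of_differentiableOn`, `osgoodLemma_holds`) — so THIS MODULE types (K′) from (J0′)'s clauses
VERBATIM, with no change at the w1 source.

THE CONSTRUCTION ([15] (15) p. 280 «`U = U′U₀`» read bondwise in the left-trivialised chart).  `U₀ :=` the real point `(p, B′) = (0, 0)` of the chart (a minimiser for the
unperturbed datum `M˙(Q_k^{s*}Ṽ_k)`); `A_Y(b) := U₀(b)⋆ · Ũ(0, ι(ιA Y))(b)` — a unitary of determinant one, `= 1` at `Y = 0`, jointly `C^∞` in `Y` (Osgood); `X_f Y (b) := φ(Re logCoordC (A_Y(b)))`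
with `logCoordC` the holomorphic logarithmic chart of `SL₂(ℂ)` at `1` (`B15SU2ChartHolomorphic`, dag-n12-w1: `expPointC ∘ logCoordC = id` on `‖A − 1‖ ≤ 1∕3`, `det A = 1`; the unitary
real structure `θ(A) = (A⋆)⁻¹` is coordinatewise conjugation, so the coordinates of a UNITARY `A` are REAL) and `φ : ℝ³ ≃ 𝔰𝔲(2)` the tree's identification
`v ↦ quatMatrix (ι v) = Σ_a v_a E_a`.  Then `U₀(b) · exp(X_f Y (b)) = U₀(b) · A_Y(b) = Ũ(0, ι(ιA Y))(b)` is the matrix of the minimiser `U′_Y` of (J0′)'s third clause, for every `Y` with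
`‖ιA Y‖ < R` and `‖A_Y(b) − 1‖ ≤ 1∕3` (both hold near `0` by continuity) — so `expChart U₀ (X_f Y) = U′_Y` IS a minimiser; and `X_f` is `C²` (indeed `Cⁿ` for every `n`) at `0` by the chain
`SCV.contDiffOn_nat` (entries ⇒ matrix via `Matrix.ofLinearEquiv`) → `restrict_scalars ℝ` → the ℝ-linear parameter map `Y ↦ (0, ιAc (ι Y))` → left multiplication by `U₀(b)⋆` → `logCoordC`
(`C^∞` on `‖A − 1‖ < 1` by `differentiableAt_logCoordC` + Osgood again) → `Re` → `φ`.

CONTENTS (theorems only; no `def`, no `instance`, no `sorry`).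
* §1 regularity — `contDiffOn_matrix_of_entries` (entrywise `DifferentiableOn ℂ` on an open set of a finite-dimensional complex space ⇒ the `M₂(ℂ)`-valued map is `Cⁿ`, every `n`),
  `contDiffAt_logCoordC` (the logarithmic coordinates are `Cⁿ` on `‖A − 1‖ < 1`), `contDiff_reVec` (coordinatewise real part `ℂ³ → ℝ³` is real-`C^∞`), `logCoordC_one`.
* §2 algebra — `logCoordC_re_of_mem_unitaryGroup` (the logarithmic coordinates of a small UNITARY are real), `exp_coe_eq_expPointC` (`exp (φ v) = expPointC (v : ℂ³)`),
  ★ `coe_mul_exp_logChart_eq` (`g · exp(φ(Re logCoordC(g⋆h))) = h` for `g h ∈ SU(2)` with `‖g⋆h − 1‖ ≤ 1∕3`).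
* §3 ★★★ `exists_realChartFamily_of_minimiserChart` — EXACTLY the lane owner's target signature (bus l.29129): (J0′)'s clauses 1 and 3 at one base field ⊢
  `∃ U₀ X_f, X_f 0 = 0 ∧ ContDiffAt ℝ 2 X_f 0 ∧ IsMinimizer … (Q_k^{s*}Ṽ_k) U₀ ∧ ∀ᶠ Y in 𝓝 0, IsMinimizer … (exp(i·ιA Y)·Ṽ_k) (expChart U₀ (X_f Y))`.
* §4 corollaries — `binders_of_contDiffAt_two` (generic: the binder triple of p604041 §2 from `ContDiffAt ℝ 2`), ★ `exists_realChartFamily_binders` (§3 with the triple),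
  ★★ `exists_realChartFamily_hval_bgOfRecord` ((c2): at `𝔹 := 𝐁_k(Z)` and NODE 00's totalised solution map `bgOfRecord av reg`, the family AND the value identity `hval` of p604041 §4
  for `f := fun177std (bgOfRecord av reg) M₁ Z k`, by the lane's §1 `eventually_sliceFn_fun177std_bgOfRecord_eq_wilsonAction4`), ★★ `exists_realChartFamily_hval_atRecord` ((c3): the same at
  the endpoints' objects `Node00.avOfRecord F 2 Kt` ∕ `Node00.regMSCoPOfRecord F 2 ν Kt k′ Ω` ∕ `𝐁_k(Z)` with `M₁`, via `eventually_sliceFn_fun177std_bgMSCoPOfRecord_eq_wilsonAction4`).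
HONEST SCOPE: finite-dimensional calculus (several-complex-variables smoothness from the tree's Osgood file) and `SU(2)` chart algebra on the tree's objects; the letter (J0′) — the
EXISTENCE of the holomorphic minimiser chart, [15] Prop. 9 (190) ∕ Thm 1 — stays a HYPOTHESIS (its producer is the w1 lineage's `hMin…` theorems, themselves modulo [15] Thm 1's
displayed letters); (J0′)'s second clause (the bound `𝓐₀`) is not used; nothing of Bałaban's estimates is asserted; N12 NOT discharged; K1⁷ NOT closed.
-/

noncomputable section

open Set Metric Filter
open scoped Topology ContDiff Matrix.Norms.L2Operator ComplexConjugate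

namespace Literature.MathematicalPhysics.QuantumFieldTheory.Balaban1983to89.B15Prop1RealChartFamilyFromMinimiserChart

open B15Prop1SliceCoordinates (GaugeSlice ιA norm_ιA_apply_le)
open B15Prop1SliceTaylorCalculus (sliceFn ιAc cplxSliceL cplxSliceL_apply ιAc_cplxSlice)
open B15Prop1ChartCalculusSU2 (E3)
open B15Prop1ChartSU2 (su2Chart)
open T4CubeChartGnomonic (SU2)
open T4Continuum B15DeterminingSets GaugeField
open T4AdjointCovarianceUnitary (lieSU expSU coe_expSU)
open Node00
open B15Eq177ValueInvariance B15Sect1Instances B14.Eq213DetSet B14.Eq216Concrete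
open B15Prop1SliceHessianOfChartFamily (eventually_sliceFn_fun177std_bgOfRecord_eq_wilsonAction4 eventually_sliceFn_fun177std_bgMSCoPOfRecord_eq_wilsonAction4)
open B16Sect1Backgrounds (expMul expMul_zero)
open B15Prop1AnalyticExtClause (cplxVec norm_cplxVec)
open B15SU2ChartHolomorphic (expPointC logCoordC genE quatMatrix_imQuat expPointC_logCoordC logCoordC_theta differentiableAt_logCoordC
  logCoordC_expPointC)
open Literature.MathematicalPhysics.QuantumLattice (quatMatrix)
open T4HaarSU2ExpChart (imQuat)
open Literature.MathematicalPhysics.QuantumFieldTheory.BalabanImbrieJaffe1984to88.BIJ85Eq453GaugeField (qsstarGIter0)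

/-! ## §1  Regularity: several-complex-variables smoothness of the chart ingredients -/

section Regularity

/-- **ENTRYWISE HOLOMORPHIC ⇒ SMOOTH (several complex variables).**  On an open subset `O` of a finite-dimensional complex normed space, an `M₂(ℂ)`-valued map whose four
entries are `DifferentiableOn ℂ` is `Cⁿ` over `ℂ` for every finite `n` — the tree's Osgood half `Literature.Analysis.Complex.SCV.contDiffOn_nat` entry by entry, reassembled through
`Matrix.ofLinearEquiv` (the `L²`-operator-normed matrices are a continuous-linear image of `Fin 2 → Fin 2 → ℂ`).  This is the regularity step of (J0′) ⇒ (K′).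
[cite: HormanderSCV1973, Thm 2.2.1; Balaban1985Variational, Prop. 9 (190) p.309 («analytic function of Gᶜ-valued small configurations»)] -/
theorem contDiffOn_matrix_of_entries {X : Type*} [NormedAddCommGroup X] [NormedSpace ℂ X] [FiniteDimensional ℂ X]
    {f : X → Matrix (Fin 2) (Fin 2) ℂ} {O : Set X} (hO : IsOpen O)
    (hf : ∀ a c, DifferentiableOn ℂ (fun z => f z a c) O) (n : ℕ) : ContDiffOn ℂ n f O := by
  let e : (Fin 2 → Fin 2 → ℂ) ≃L[ℂ] Matrix (Fin 2) (Fin 2) ℂ := (Matrix.ofLinearEquiv ℂ).toContinuousLinearEquiv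
  have hfun : f = fun z => e (fun a c => f z a c) := by
    funext z
    rfl
  rw [hfun]
  exact e.contDiff.comp_contDiffOn (contDiffOn_pi.2 fun a => contDiffOn_pi.2 fun c =>
    Literature.Analysis.Complex.SCV.contDiffOn_nat (hf a c) hO n)

/-- **THE HOLOMORPHIC LOGARITHMIC COORDINATES ARE `Cⁿ`** at every `A` with `‖A − 1‖ < 1`: `B15SU2ChartHolomorphic.differentiableAt_logCoordC` on the open unit ball about `1`, upgraded by
Osgood (`SCV.contDiffOn_nat`). [cite: Balaban1985Averaging, (21) p.21 («analytic functions of complex matrices»); HormanderSCV1973, Thm 2.2.1] -/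
theorem contDiffAt_logCoordC {A : Matrix (Fin 2) (Fin 2) ℂ} (hA : ‖A - 1‖ < 1) (n : ℕ) : ContDiffAt ℂ n logCoordC A := by
  have hO : IsOpen {B : Matrix (Fin 2) (Fin 2) ℂ | ‖B - 1‖ < 1} :=
    isOpen_lt (continuous_id.sub continuous_const).norm continuous_const
  have hd : DifferentiableOn ℂ logCoordC {B : Matrix (Fin 2) (Fin 2) ℂ | ‖B - 1‖ < 1} := fun B hB =>
    (differentiableAt_logCoordC hB).differentiableWithinAt
  exact (Literature.Analysis.Complex.SCV.contDiffOn_nat hd hO n).contDiffAt (hO.mem_nhds hA)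

/-- **THE COORDINATEWISE REAL PART `ℂ³ → ℝ³` IS REAL-SMOOTH** (a continuous real-linear map, written as a lambda: this file has no definitions). [cite: Balaban1989LargeFieldI, Prop. 1 p.194 («B′ ∈ 𝔤ᶜ» ⊃ real `B′ ∈ 𝔤`, bookkeeping)] -/
theorem contDiff_reVec {n : WithTop ℕ∞} :
    ContDiff ℝ n (fun z : EuclideanSpace ℂ (Fin 3) => (WithLp.toLp 2 fun a => (z a).re : EuclideanSpace ℝ (Fin 3))) := by
  refine (contDiff_piLp 2).2 fun a => ?_
  have h1 : ContDiff ℝ n (fun z : EuclideanSpace ℂ (Fin 3) => z a) :=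
    ((EuclideanSpace.proj a : EuclideanSpace ℂ (Fin 3) →L[ℂ] ℂ).restrictScalars ℝ).contDiff
  exact Complex.reCLM.contDiff.comp h1

/-- The logarithmic coordinates of the identity vanish: `logCoordC 1 = 0` (`expPointC 0 = 1` and `logCoordC ∘ expPointC = id` near `0`). [cite: Balaban1985Averaging, (21) p.21 (bookkeeping)] -/
theorem logCoordC_one : logCoordC 1 = 0 := by
  have h := logCoordC_expPointC 0 (by simp [Real.log_pos (by norm_num : (1:ℝ) < 2)])
  have h1 : expPointC 0 = 1 := by
    simp [expPointC]
  rw [h1] at h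
  exact h

end Regularity

/-! ## §2  Algebra: the left-trivialised exponential chart reproduces a nearby unitary through the real logarithmic coordinates -/

section Algebra

/-- **THE LOGARITHMIC COORDINATES OF A SMALL UNITARY ARE REAL**: for `A` unitary with `‖A − 1‖ ≤ 1∕3`, `(Re (logCoordC A)_a : ℂ) = (logCoordC A)_a` — the unitary real structure
`θ(A) = (A⋆)⁻¹` fixes `A` and is coordinatewise conjugation in the chart (`B15SU2ChartHolomorphic.logCoordC_theta`). [cite: Balaban1985Variational, p.307 («Gᶜ-valued fields»), Prop. 9 (190) p.309; Balaban1989LargeFieldII, (1.19) p.360 («(1/i) log»)] -/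
theorem logCoordC_re_of_mem_unitaryGroup {A : Matrix (Fin 2) (Fin 2) ℂ} (hU : A ∈ Matrix.unitaryGroup (Fin 2) ℂ) (hA : ‖A - 1‖ ≤ 1 / 3)
    (a : Fin 3) : (((logCoordC A a).re : ℝ) : ℂ) = logCoordC A a := by
  have hinv : (star A)⁻¹ = A := Matrix.inv_eq_right_inv (Matrix.mem_unitaryGroup_iff'.1 hU)
  have h := logCoordC_theta hA
  rw [hinv] at h
  have ha : logCoordC A a = conj (logCoordC A a) := by
    have h' := congrArg (fun z : EuclideanSpace ℂ (Fin 3) => z a) h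
    simpa using h'
  exact Complex.conj_eq_iff_re.1 ha.symm

/-- **`exp ∘ φ` IS THE COMPLEXIFIED CHART ON REAL ARGUMENTS**: for the identification `φ : ℝ³ → 𝔰𝔲(2)`, `φ v = quatMatrix (ι v) = Σ_a v_a E_a` (`quatMatrix_imQuat`), one has
`exp (φ v) = expPointC (v : ℂ³)`. [cite: Balaban1989LargeFieldII, (1.19) p.360; Balaban1989LargeFieldI, Prop. 1 p.194] -/
theorem exp_coe_eq_expPointC (φ : EuclideanSpace ℝ (Fin 3) →ₗ[ℝ] lieSU (Fin 2))
    (hφ : ∀ v, ((φ v : lieSU (Fin 2)) : Matrix (Fin 2) (Fin 2) ℂ) = quatMatrix (imQuat v)) (v : EuclideanSpace ℝ (Fin 3)) :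
    NormedSpace.exp ((φ v : lieSU (Fin 2)) : Matrix (Fin 2) (Fin 2) ℂ) = expPointC (WithLp.toLp 2 fun a => ((v a : ℝ) : ℂ)) := by
  rw [hφ, quatMatrix_imQuat, expPointC]

/-- ★ **THE LEFT-TRIVIALISED EXPONENTIAL CHART REPRODUCES A NEARBY GROUP ELEMENT THROUGH THE REAL LOGARITHMIC COORDINATES**: for `g h ∈ SU(2)` with `‖g⋆h − 1‖ ≤ 1∕3`,
`g · exp(φ(Re logCoordC(g⋆h))) = h` (`expPointC ∘ logCoordC = id` on small `SL₂(ℂ)` matrices, reality of the coordinates of the unitary `g⋆h`, `g g⋆ = 1`) — [15] (15) «`U = U′U₀`»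
read bondwise with `U′ = U₀ exp(X) U₀⁻¹`. [cite: Balaban1985Variational, (15) p.280, p.307; Balaban1985Averaging, (21) p.21; Balaban1989LargeFieldII, (1.19) p.360] -/
theorem coe_mul_exp_logChart_eq (φ : EuclideanSpace ℝ (Fin 3) →ₗ[ℝ] lieSU (Fin 2))
    (hφ : ∀ v, ((φ v : lieSU (Fin 2)) : Matrix (Fin 2) (Fin 2) ℂ) = quatMatrix (imQuat v)) (g h : SU2)
    (hA : ‖star ((g : SU2) : Matrix (Fin 2) (Fin 2) ℂ) * ((h : SU2) : Matrix (Fin 2) (Fin 2) ℂ) - 1‖ ≤ 1 / 3) :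
    ((g : SU2) : Matrix (Fin 2) (Fin 2) ℂ) *
        NormedSpace.exp ((φ (WithLp.toLp 2 fun a =>
          (logCoordC (star ((g : SU2) : Matrix (Fin 2) (Fin 2) ℂ) * ((h : SU2) : Matrix (Fin 2) (Fin 2) ℂ)) a).re) : lieSU (Fin 2)) :
            Matrix (Fin 2) (Fin 2) ℂ) = ((h : SU2) : Matrix (Fin 2) (Fin 2) ℂ) := by
  set A : Matrix (Fin 2) (Fin 2) ℂ := star ((g : SU2) : Matrix (Fin 2) (Fin 2) ℂ) * ((h : SU2) : Matrix (Fin 2) (Fin 2) ℂ) with hAdef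
  have hcoe : A = (((star g * h : SU2)) : Matrix (Fin 2) (Fin 2) ℂ) := by
    rw [hAdef, Submonoid.coe_mul, Matrix.specialUnitaryGroup.coe_star]
  have hAU : A ∈ Matrix.unitaryGroup (Fin 2) ℂ := by rw [hcoe]; exact (star g * h).prop.1
  have hdet : A.det = 1 := by rw [hcoe]; exact (star g * h).prop.2
  rw [exp_coe_eq_expPointC φ hφ]
  have hre : (WithLp.toLp 2 fun a => (((logCoordC A a).re : ℝ) : ℂ)) = logCoordC A := by
    ext a
    simpa using logCoordC_re_of_mem_unitaryGroup hAU hA a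
  rw [hre, expPointC_logCoordC hA hdet, hAdef, ← mul_assoc, Matrix.mem_unitaryGroup_iff.1 g.prop.1, one_mul]

end Algebra

/-! ## §3  The real chart family -/

section Main

variable {P : Params} {k : ℕ} [DecidableEq (PBond P k)]

/-- ★★★ **(K′) THE REAL `C²` FAMILY OF (2.12) MINIMISERS IN THE EXPONENTIAL CHART AT `U₀`, FROM THE INTRINSIC ANALYTIC LETTER (J0′)** — the lane owner's target signature
(dag-n12-c g17, bus l.29129), hypotheses = (J0′)'s clauses 1 and 3 VERBATIM at one base field `Ṽ_k` (`B15Prop1JointHolomorphyFromMinimiserFamilyOneSided` :102): a chart `Ũ` on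
the ball of radius `R` of the complexified parameters with ℂ-differentiable entries (`hdiff`) whose real points are matrix fields of (2.12) minimisers of the data
`M˙(Q_k^{s*}(exp(iB′)·ext(exp(ip)Ṽ_k)))` in the class `reg` on `𝔹` (`hreal`).  CONCLUSION: a base minimiser `U₀` (the real point `(0,0)`) for `M˙(Q_k^{s*}(ext Ṽ_k))` and a map
`X_f : GaugeSlice S T E3 → (bonds → 𝔰𝔲(2))`, `X_f 0 = 0`, `C²` at `0`, with `expChart U₀ (X_f Y)` a minimiser for `M˙(Q_k^{s*}(exp(i·ιA Y)·ext Ṽ_k))` for all `Y` near `0`.  Construction in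
the module docstring; regularity by the tree's Osgood lemma (`SCV.contDiffOn_nat`).  The letter (J0′) is a HYPOTHESIS here; nothing of [15] is asserted.
[cite: Balaban1985Variational, Thm 1 p.279, (15) p.280, Prop. 9 (190) p.309; Balaban1988Convergent, (2.12)–(2.14) pp.256–257; Balaban1989LargeFieldI, Prop. 1 p.194 (last clause); Balaban1989LargeFieldII, p.359 («Fixing the gauge G₀ for V′ … V′ = exp iB′»), (1.12) p.359; HormanderSCV1973, Thm 2.2.1] -/
theorem exists_realChartFamily_of_minimiserChart (S : Set (Site P k)) (T : Finset (PBond P k))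
    (φ : EuclideanSpace ℝ (Fin 3) →ₗ[ℝ] lieSU (Fin 2)) (hφ : ∀ v, ((φ v : lieSU (Fin 2)) : Matrix (Fin 2) (Fin 2) ℂ) = quatMatrix (imQuat v))
    (av : ∀ j, Averaging P j SU2) (reg : Set (GaugeField P 0 SU2)) (𝔹 : DetSet P)
    (ext : GaugeField P k SU2 → GaugeField P k SU2) (Vk : GaugeField P k SU2) {R : ℝ} (hR : 0 < R)
    (Ũ : VecField P k (EuclideanSpace ℂ (Fin 3)) × VecField P k (EuclideanSpace ℂ (Fin 3)) → PBond P 0 → Matrix (Fin 2) (Fin 2) ℂ)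
    (hdiff : ∀ b a c, DifferentiableOn ℂ (fun z => Ũ z b a c) (ball 0 R))
    (hreal : ∀ p B' : VecField P k E3, ‖p‖ < R → ‖B'‖ < R → ∃ U' : GaugeField P 0 SU2,
      (∀ b, Ũ (cplxVec p, cplxVec B') b = ((U' b : SU2) : Matrix (Fin 2) (Fin 2) ℂ)) ∧
        IsMinimizer av reg 𝔹 (avgFamily av (qsstarGIter0 k (expMul su2Chart B' (ext (expMul su2Chart p Vk))))) U') :
    ∃ U₀ : GaugeField P 0 SU2, ∃ Xf : GaugeSlice S T E3 → PBond P 0 → lieSU (Fin 2),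
      Xf 0 = 0 ∧ ContDiffAt ℝ 2 Xf 0 ∧ IsMinimizer av reg 𝔹 (avgFamily av (qsstarGIter0 k (ext Vk))) U₀ ∧
        ∀ᶠ Y in 𝓝 (0 : GaugeSlice S T E3),
          IsMinimizer av reg 𝔹 (avgFamily av (qsstarGIter0 k (expMul su2Chart (ιA S T Y) (ext Vk)))) (expChart U₀ (Xf Y)) := by
  -- the base minimiser: the `hreal` witness at `(p, B′) = (0, 0)`
  have h0R : ‖(0 : VecField P k E3)‖ < R := by simpa using hR
  obtain ⟨U₀, hU₀eq, hU₀min⟩ := hreal 0 0 h0R h0R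
  rw [expMul_zero, expMul_zero] at hU₀min
  have hcv0 : cplxVec (0 : VecField P k E3) = 0 := by
    funext b; ext i; simp [cplxVec]
  -- the ℝ-affine parameter map of the slice into the complexified chart parameters
  set g : GaugeSlice S T E3 → VecField P k (EuclideanSpace ℂ (Fin 3)) × VecField P k (EuclideanSpace ℂ (Fin 3)) :=
    fun Y => (cplxVec (0 : VecField P k E3), cplxVec (ιA S T Y)) with hgdef
  have hg0 : g 0 = 0 := by
    simp only [hgdef, map_zero, hcv0]; rfl
  have hg2 : ContDiff ℝ ((2 : ℕ) : WithTop ℕ∞) (fun Y : GaugeSlice S T E3 => cplxVec (ιA S T Y)) := by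
    have h := (((ιAc S T).restrictScalars ℝ).comp (cplxSliceL S T)).contDiff (n := ((2 : ℕ) : WithTop ℕ∞))
    have hfun : (fun Y : GaugeSlice S T E3 => cplxVec (ιA S T Y)) =
        fun Y => ((ιAc S T).restrictScalars ℝ) (cplxSliceL S T Y) := by
      funext Y
      rw [ContinuousLinearMap.coe_restrictScalars', cplxSliceL_apply, ιAc_cplxSlice]
    rw [hfun]
    exact h
  have hgC : ContDiff ℝ ((2 : ℕ) : WithTop ℕ∞) g := contDiff_const.prodMk hg2
  -- the value at the base: `U₀⋆ · Ũ(0) = 1` bondwise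
  have hA0 : ∀ b, star ((U₀ b : SU2) : Matrix (Fin 2) (Fin 2) ℂ) * Ũ (g 0) b = 1 := fun b => by
    have hg0' : g 0 = (cplxVec (0 : VecField P k E3), cplxVec (0 : VecField P k E3)) := by
      simp only [hgdef, map_zero]
    rw [hg0', hU₀eq b]
    exact Matrix.mem_unitaryGroup_iff'.1 (U₀ b).prop.1
  -- regularity, bond by bond
  have hMb : ∀ b, ContDiffAt ℝ ((2 : ℕ) : WithTop ℕ∞) (fun Y => star ((U₀ b : SU2) : Matrix (Fin 2) (Fin 2) ℂ) * Ũ (g Y) b) 0 :=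
      fun b => by
    have h1 : ContDiffOn ℂ ((2 : ℕ) : WithTop ℕ∞) (fun z => Ũ z b) (ball 0 R) := contDiffOn_matrix_of_entries isOpen_ball (hdiff b) 2
    have h2 : ContDiffAt ℂ ((2 : ℕ) : WithTop ℕ∞) (fun z => star ((U₀ b : SU2) : Matrix (Fin 2) (Fin 2) ℂ) * Ũ z b) 0 :=
      contDiffAt_const.mul (h1.contDiffAt (isOpen_ball.mem_nhds (mem_ball_self hR)))
    have h3 : ContDiffAt ℝ ((2 : ℕ) : WithTop ℕ∞) (fun z => star ((U₀ b : SU2) : Matrix (Fin 2) (Fin 2) ℂ) * Ũ z b) (g 0) := by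
      rw [hg0]; exact h2.restrict_scalars ℝ
    exact h3.comp 0 hgC.contDiffAt
  have hLb : ∀ b, ContDiffAt ℝ ((2 : ℕ) : WithTop ℕ∞)
      (fun Y => logCoordC (star ((U₀ b : SU2) : Matrix (Fin 2) (Fin 2) ℂ) * Ũ (g Y) b)) 0 := fun b => by
    have h3 : ContDiffAt ℝ ((2 : ℕ) : WithTop ℕ∞) logCoordC (star ((U₀ b : SU2) : Matrix (Fin 2) (Fin 2) ℂ) * Ũ (g 0) b) := by
      rw [hA0 b]
      exact (contDiffAt_logCoordC (A := 1) (by simp) 2).restrict_scalars ℝ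
    have h4 := h3.comp 0 (hMb b)
    exact h4
  have hXb : ∀ b, ContDiffAt ℝ ((2 : ℕ) : WithTop ℕ∞) (fun Y => φ (WithLp.toLp 2 fun a =>
      (logCoordC (star ((U₀ b : SU2) : Matrix (Fin 2) (Fin 2) ℂ) * Ũ (g Y) b) a).re)) 0 := fun b => by
    have h5 := (contDiff_reVec (n := ((2 : ℕ) : WithTop ℕ∞))).contDiffAt.comp 0 (hLb b)
    have h6 := (LinearMap.toContinuousLinearMap φ).contDiff (n := ((2 : ℕ) : WithTop ℕ∞)) |>.contDiffAt.comp 0 h5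
    exact h6
  -- eventual smallness of `U₀⋆ · Ũ(0, ιA Y) − 1` and of `ιA Y`
  have hsmall : ∀ᶠ Y in 𝓝 (0 : GaugeSlice S T E3), ∀ b, ‖star ((U₀ b : SU2) : Matrix (Fin 2) (Fin 2) ℂ) * Ũ (g Y) b - 1‖ ≤ 1 / 3 := by
    refine eventually_all.2 fun b => ?_
    have hc : ContinuousAt (fun Y => star ((U₀ b : SU2) : Matrix (Fin 2) (Fin 2) ℂ) * Ũ (g Y) b) 0 := (hMb b).continuousAt
    have ht : Tendsto (fun Y => ‖star ((U₀ b : SU2) : Matrix (Fin 2) (Fin 2) ℂ) * Ũ (g Y) b - 1‖) (𝓝 0) (𝓝 0) := by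
      have h := ((hc.sub (continuousAt_const : ContinuousAt (fun _ : GaugeSlice S T E3 => (1 : Matrix (Fin 2) (Fin 2) ℂ)) 0)).norm).tendsto
      simpa only [Pi.sub_apply, hA0 b, sub_self, norm_zero] using h
    exact ht.eventually (Iic_mem_nhds (by norm_num : (0 : ℝ) < 1 / 3))
  have hnormR : ∀ᶠ Y in 𝓝 (0 : GaugeSlice S T E3), ‖ιA S T Y‖ < R := by
    filter_upwards [Metric.ball_mem_nhds (0 : GaugeSlice S T E3) hR] with Y hY
    rw [mem_ball_zero_iff] at hY
    exact lt_of_le_of_lt ((pi_norm_le_iff_of_nonneg (norm_nonneg Y)).2 fun b => norm_ιA_apply_le Y b) hY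
  -- assemble
  refine ⟨U₀, fun Y b => φ (WithLp.toLp 2 fun a =>
      (logCoordC (star ((U₀ b : SU2) : Matrix (Fin 2) (Fin 2) ℂ) * Ũ (cplxVec (0 : VecField P k E3), cplxVec (ιA S T Y)) b) a).re),
    ?_, ?_, hU₀min, ?_⟩
  · -- `Xf 0 = 0`
    funext b
    show φ _ = 0
    have hz : (WithLp.toLp 2 fun a => (logCoordC (star ((U₀ b : SU2) : Matrix (Fin 2) (Fin 2) ℂ) *
        Ũ (cplxVec (0 : VecField P k E3), cplxVec (ιA S T 0)) b) a).re : EuclideanSpace ℝ (Fin 3)) = 0 := by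
      have h1 : star ((U₀ b : SU2) : Matrix (Fin 2) (Fin 2) ℂ) * Ũ (cplxVec (0 : VecField P k E3), cplxVec (ιA S T 0)) b = 1 := by
        rw [map_zero, hU₀eq b]
        exact Matrix.mem_unitaryGroup_iff'.1 (U₀ b).prop.1
      rw [h1, logCoordC_one]
      ext a
      simp
    rw [hz, map_zero]
  · -- `C²` at `0`
    have h := contDiffAt_pi.2 fun b => hXb b
    exact_mod_cast h
  · -- the family of minimisers near `0`
    filter_upwards [hsmall, hnormR] with Y hsY hYR
    obtain ⟨U', hU'eq, hU'min⟩ := hreal 0 (ιA S T Y) h0R hYR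
    rw [expMul_zero] at hU'min
    have hchart : expChart U₀ (fun b => φ (WithLp.toLp 2 fun a =>
        (logCoordC (star ((U₀ b : SU2) : Matrix (Fin 2) (Fin 2) ℂ) * Ũ (cplxVec (0 : VecField P k E3), cplxVec (ιA S T Y)) b) a).re)) = U' := by
      funext b
      apply Subtype.ext
      rw [coe_expChart, hU'eq b]
      have hA : ‖star ((U₀ b : SU2) : Matrix (Fin 2) (Fin 2) ℂ) * ((U' b : SU2) : Matrix (Fin 2) (Fin 2) ℂ) - 1‖ ≤ 1 / 3 := by
        have h := hsY b
        rwa [show g Y = (cplxVec (0 : VecField P k E3), cplxVec (ιA S T Y)) from rfl, hU'eq b] at h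
      exact coe_mul_exp_logChart_eq φ hφ (U₀ b) (U' b) hA
    rw [hchart]
    exact hU'min

end Main

/-! ## §4  Corollaries: the binder triple, and the value identity `hval` at NODE 00's solution maps -/

section Corollaries

/-- **THE BINDER TRIPLE OF A `C²` POINT** (generic real calculus): `ContDiffAt ℝ 2 X_f x` gives `HasFDerivAt X_f (D X_f x) x`, `HasFDerivAt (D X_f) (D² X_f x) x` and differentiability
near `x` — the three family binders `hX`, `hX₂`, `hXd` of `B15Prop1SliceHessianOfChartFamily` §2 (dag-n12-w3's critical-family currency). [cite: Balaban1985Variational, (81) p.290 (bookkeeping: second-order expansion along a family)] -/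
theorem binders_of_contDiffAt_two {E F : Type*} [NormedAddCommGroup E] [NormedSpace ℝ E] [NormedAddCommGroup F] [NormedSpace ℝ F]
    {Xf : E → F} {x : E} (h : ContDiffAt ℝ 2 Xf x) :
    HasFDerivAt Xf (fderiv ℝ Xf x) x ∧ HasFDerivAt (fun Y => fderiv ℝ Xf Y) (fderiv ℝ (fderiv ℝ Xf) x) x ∧
      ∀ᶠ Y in 𝓝 x, DifferentiableAt ℝ Xf Y := by
  refine ⟨(h.differentiableAt (by norm_num)).hasFDerivAt, ?_, ?_⟩
  · have h1 : ContDiffAt ℝ 1 (fderiv ℝ Xf) x := h.fderiv_right (by norm_num)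
    exact (h1.differentiableAt one_ne_zero).hasFDerivAt
  · exact (h.eventually (by simp)).mono fun Y hY => hY.differentiableAt (by norm_num)

variable {P : Params} {k : ℕ} [DecidableEq (PBond P k)]

/-- ★ **(K′) WITH THE BINDER TRIPLE**: `exists_realChartFamily_of_minimiserChart` together with `HasFDerivAt X_f (D X_f 0) 0`, `HasFDerivAt (D X_f) (D² X_f 0) 0`,
`∀ᶠ Y, DifferentiableAt ℝ X_f Y` — the shape consumed by `B15Prop1SliceHessianOfChartFamily.hasFDerivAt_fderiv_sliceFn_of_chartFamily` ∕ §4. [cite: Balaban1985Variational, Prop. 9 (190) p.309, (81) p.290; Balaban1989LargeFieldII, (1.12) p.359] -/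
theorem exists_realChartFamily_binders (S : Set (Site P k)) (T : Finset (PBond P k))
    (φ : EuclideanSpace ℝ (Fin 3) →ₗ[ℝ] lieSU (Fin 2)) (hφ : ∀ v, ((φ v : lieSU (Fin 2)) : Matrix (Fin 2) (Fin 2) ℂ) = quatMatrix (imQuat v))
    (av : ∀ j, Averaging P j SU2) (reg : Set (GaugeField P 0 SU2)) (𝔹 : DetSet P)
    (ext : GaugeField P k SU2 → GaugeField P k SU2) (Vk : GaugeField P k SU2) {R : ℝ} (hR : 0 < R)
    (Ũ : VecField P k (EuclideanSpace ℂ (Fin 3)) × VecField P k (EuclideanSpace ℂ (Fin 3)) → PBond P 0 → Matrix (Fin 2) (Fin 2) ℂ)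
    (hdiff : ∀ b a c, DifferentiableOn ℂ (fun z => Ũ z b a c) (ball 0 R))
    (hreal : ∀ p B' : VecField P k E3, ‖p‖ < R → ‖B'‖ < R → ∃ U' : GaugeField P 0 SU2,
      (∀ b, Ũ (cplxVec p, cplxVec B') b = ((U' b : SU2) : Matrix (Fin 2) (Fin 2) ℂ)) ∧
        IsMinimizer av reg 𝔹 (avgFamily av (qsstarGIter0 k (expMul su2Chart B' (ext (expMul su2Chart p Vk))))) U') :
    ∃ U₀ : GaugeField P 0 SU2, ∃ Xf : GaugeSlice S T E3 → PBond P 0 → lieSU (Fin 2),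
      Xf 0 = 0 ∧ ContDiffAt ℝ 2 Xf 0 ∧
      HasFDerivAt Xf (fderiv ℝ Xf 0) 0 ∧ HasFDerivAt (fun Y => fderiv ℝ Xf Y) (fderiv ℝ (fderiv ℝ Xf) 0) 0 ∧
      (∀ᶠ Y in 𝓝 (0 : GaugeSlice S T E3), DifferentiableAt ℝ Xf Y) ∧
      IsMinimizer av reg 𝔹 (avgFamily av (qsstarGIter0 k (ext Vk))) U₀ ∧
        ∀ᶠ Y in 𝓝 (0 : GaugeSlice S T E3),
          IsMinimizer av reg 𝔹 (avgFamily av (qsstarGIter0 k (expMul su2Chart (ιA S T Y) (ext Vk)))) (expChart U₀ (Xf Y)) := by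
  obtain ⟨U₀, Xf, h0, h2, hmin0, hmin⟩ := exists_realChartFamily_of_minimiserChart S T φ hφ av reg 𝔹 ext Vk hR Ũ hdiff hreal
  obtain ⟨hd1, hd2, hdd⟩ := binders_of_contDiffAt_two h2
  exact ⟨U₀, Xf, h0, h2, hd1, hd2, hdd, hmin0, hmin⟩

/-- ★★ **(c2) (K′) AND THE VALUE IDENTITY `hval` AT NODE 00's TOTALISED SOLUTION MAP `bgOfRecord av reg`, DETERMINING SET `𝐁_k(Z)`**: from (J0′)'s clauses at the base field
`Ṽ_k` (any averaging `av`, any class `reg`): the family `(U₀, X_f)` with its binder triple, AND print's function along the slice equals the action of the family near `0`,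
`sliceFn S T (fun177std (bgOfRecord av reg) M₁ Z k) Ṽ_k Y = A(expChart U₀ (X_f Y))` ((1.77) is the VALUE of the constrained problem — the lane's §1
`eventually_sliceFn_fun177std_bgOfRecord_eq_wilsonAction4`) = the hypothesis `hval` of p604041 §2–§4 INHABITED modulo (J0′). [cite: Balaban1989LargeFieldI, (1.74) p.192, (1.77) and Prop. 1 p.194; Balaban1989LargeFieldII, p.359; Balaban1988Convergent, (2.12) p.256; Balaban1985Variational, Prop. 9 (190) p.309] -/
theorem exists_realChartFamily_hval_bgOfRecord (S : Set (Site P k)) (T : Finset (PBond P k))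
    (φ : EuclideanSpace ℝ (Fin 3) →ₗ[ℝ] lieSU (Fin 2)) (hφ : ∀ v, ((φ v : lieSU (Fin 2)) : Matrix (Fin 2) (Fin 2) ℂ) = quatMatrix (imQuat v))
    (av : ∀ j, Averaging P j SU2) (reg : Set (GaugeField P 0 SU2)) (M₁ : ℕ) (Z : Set (Site P 0))
    (ext : GaugeField P k SU2 → GaugeField P k SU2) (Vk : GaugeField P k SU2) {R : ℝ} (hR : 0 < R)
    (Ũ : VecField P k (EuclideanSpace ℂ (Fin 3)) × VecField P k (EuclideanSpace ℂ (Fin 3)) → PBond P 0 → Matrix (Fin 2) (Fin 2) ℂ)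
    (hdiff : ∀ b a c, DifferentiableOn ℂ (fun z => Ũ z b a c) (ball 0 R))
    (hreal : ∀ p B' : VecField P k E3, ‖p‖ < R → ‖B'‖ < R → ∃ U' : GaugeField P 0 SU2,
      (∀ b, Ũ (cplxVec p, cplxVec B') b = ((U' b : SU2) : Matrix (Fin 2) (Fin 2) ℂ)) ∧
        IsMinimizer av reg (Bj M₁ Z k) (avgFamily av (qsstarGIter0 k (expMul su2Chart B' (ext (expMul su2Chart p Vk))))) U') :
    ∃ U₀ : GaugeField P 0 SU2, ∃ Xf : GaugeSlice S T E3 → PBond P 0 → lieSU (Fin 2),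
      Xf 0 = 0 ∧ ContDiffAt ℝ 2 Xf 0 ∧
      HasFDerivAt Xf (fderiv ℝ Xf 0) 0 ∧ HasFDerivAt (fun Y => fderiv ℝ Xf Y) (fderiv ℝ (fderiv ℝ Xf) 0) 0 ∧
      (∀ᶠ Y in 𝓝 (0 : GaugeSlice S T E3), DifferentiableAt ℝ Xf Y) ∧
      IsMinimizer av reg (Bj M₁ Z k) (avgFamily av (qsstarGIter0 k (ext Vk))) U₀ ∧
      (∀ᶠ Y in 𝓝 (0 : GaugeSlice S T E3),
          IsMinimizer av reg (Bj M₁ Z k) (avgFamily av (qsstarGIter0 k (expMul su2Chart (ιA S T Y) (ext Vk)))) (expChart U₀ (Xf Y))) ∧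
        ∀ᶠ Y in 𝓝 (0 : GaugeSlice S T E3),
          sliceFn S T (fun177std (bgOfRecord av reg) M₁ Z k) (ext Vk) Y = wilsonAction4 (expChart U₀ (Xf Y)) := by
  obtain ⟨U₀, Xf, h0, h2, hd1, hd2, hdd, hmin0, hmin⟩ :=
    exists_realChartFamily_binders S T φ hφ av reg (Bj M₁ Z k) ext Vk hR Ũ hdiff hreal
  exact ⟨U₀, Xf, h0, h2, hd1, hd2, hdd, hmin0, hmin,
    eventually_sliceFn_fun177std_bgOfRecord_eq_wilsonAction4 S T av reg M₁ Z (ext Vk) hmin⟩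

/-- ★★ **(c3) THE RECORD EDITION**: (c2) at the endpoints' objects — NODE 00's averaging of record `avOfRecord F 2 Kt`, class of record `regMSCoPOfRecord F 2 ν Kt k′ Ω`
(the endpoint takes `k′ = k`, `Ω = maxDomT ν.M₁ Z`), determining set `𝐁_k(Z)` with print's `M₁`: the family `(U₀, X_f)`, its binder triple, the minimiser property near `0`, and
`sliceFn S T (fun177std (bgMSCoPOfRecord F 2 ν Kt k′ Ω) M₁ Z k) Ṽ_k Y = A(expChart U₀ (X_f Y))` near `0` (the lane's §1 `eventually_sliceFn_fun177std_bgMSCoPOfRecord_eq_wilsonAction4`).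
[cite: Balaban1989LargeFieldI, (1.74) p.192, (1.77) and Prop. 1 p.194; Balaban1989LargeFieldII, p.359; Balaban1988Convergent, (2.12) p.256; Balaban1985Variational, (2) p.278, Prop. 9 (190) p.309] -/
theorem exists_realChartFamily_hval_atRecord {F : T4Family} (ν : Stage7Numerics) (Kt k' : ℕ) (Ω : ℕ → Set (Site (F.P Kt) 0))
    (M₁ : ℕ) (Z : Set (Site (F.P Kt) 0)) {k : ℕ} [DecidableEq (PBond (F.P Kt) k)] (S : Set (Site (F.P Kt) k)) (T : Finset (PBond (F.P Kt) k))
    (φ : EuclideanSpace ℝ (Fin 3) →ₗ[ℝ] lieSU (Fin 2)) (hφ : ∀ v, ((φ v : lieSU (Fin 2)) : Matrix (Fin 2) (Fin 2) ℂ) = quatMatrix (imQuat v))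
    (ext : GaugeField (F.P Kt) k SU2 → GaugeField (F.P Kt) k SU2) (Vk : GaugeField (F.P Kt) k SU2) {R : ℝ} (hR : 0 < R)
    (Ũ : VecField (F.P Kt) k (EuclideanSpace ℂ (Fin 3)) × VecField (F.P Kt) k (EuclideanSpace ℂ (Fin 3)) →
      PBond (F.P Kt) 0 → Matrix (Fin 2) (Fin 2) ℂ)
    (hdiff : ∀ b a c, DifferentiableOn ℂ (fun z => Ũ z b a c) (ball 0 R))
    (hreal : ∀ p B' : VecField (F.P Kt) k E3, ‖p‖ < R → ‖B'‖ < R → ∃ U' : GaugeField (F.P Kt) 0 SU2,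
      (∀ b, Ũ (cplxVec p, cplxVec B') b = ((U' b : SU2) : Matrix (Fin 2) (Fin 2) ℂ)) ∧
        IsMinimizer (avOfRecord F 2 Kt) (regMSCoPOfRecord F 2 ν Kt k' Ω) (Bj M₁ Z k)
          (avgFamily (avOfRecord F 2 Kt) (qsstarGIter0 k (expMul su2Chart B' (ext (expMul su2Chart p Vk))))) U') :
    ∃ U₀ : GaugeField (F.P Kt) 0 SU2, ∃ Xf : GaugeSlice S T E3 → PBond (F.P Kt) 0 → lieSU (Fin 2),
      Xf 0 = 0 ∧ ContDiffAt ℝ 2 Xf 0 ∧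
      HasFDerivAt Xf (fderiv ℝ Xf 0) 0 ∧ HasFDerivAt (fun Y => fderiv ℝ Xf Y) (fderiv ℝ (fderiv ℝ Xf) 0) 0 ∧
      (∀ᶠ Y in 𝓝 (0 : GaugeSlice S T E3), DifferentiableAt ℝ Xf Y) ∧
      IsMinimizer (avOfRecord F 2 Kt) (regMSCoPOfRecord F 2 ν Kt k' Ω) (Bj M₁ Z k) (avgFamily (avOfRecord F 2 Kt) (qsstarGIter0 k (ext Vk))) U₀ ∧
      (∀ᶠ Y in 𝓝 (0 : GaugeSlice S T E3),
          IsMinimizer (avOfRecord F 2 Kt) (regMSCoPOfRecord F 2 ν Kt k' Ω) (Bj M₁ Z k)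
            (avgFamily (avOfRecord F 2 Kt) (qsstarGIter0 k (expMul su2Chart (ιA S T Y) (ext Vk)))) (expChart U₀ (Xf Y))) ∧
        ∀ᶠ Y in 𝓝 (0 : GaugeSlice S T E3),
          sliceFn S T (fun177std (bgMSCoPOfRecord F 2 ν Kt k' Ω) M₁ Z k) (ext Vk) Y = wilsonAction4 (expChart U₀ (Xf Y)) := by
  obtain ⟨U₀, Xf, h0, h2, hd1, hd2, hdd, hmin0, hmin⟩ :=
    exists_realChartFamily_binders S T φ hφ (avOfRecord F 2 Kt) (regMSCoPOfRecord F 2 ν Kt k' Ω) (Bj M₁ Z k) ext Vk hR Ũ hdiff hreal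
  exact ⟨U₀, Xf, h0, h2, hd1, hd2, hdd, hmin0, hmin,
    eventually_sliceFn_fun177std_bgMSCoPOfRecord_eq_wilsonAction4 ν Kt k' Ω M₁ Z S T (ext Vk) hmin⟩

end Corollaries

end Literature.MathematicalPhysics.QuantumFieldTheory.Balaban1983to89.B15Prop1RealChartFamilyFromMinimiserChart

end
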